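import Summits.BirchSwinnertonDyer.BirchSwinnertonDyer.Theorems.ManinLocalTwoThreeGammaOneKatoRoadHolds
import Summits.BirchSwinnertonDyer.BirchSwinnertonDyer.Theorems.ManinLocalTwoThreeGammaOneKatoRoad
import Summits.BirchSwinnertonDyer.Rank1Residual.ManinAdditive.TowerUnitTwist
import Literature.NumberTheory.EllipticCurves.KatoAdditiveTwistedValueNeronIntegralitySymbolClosure
import Literature.NumberTheory.EllipticCurves.SkinnerUrban2014.PAdicUnitPeriodRatioAnyPrimeProofs
import Literature.NumberTheory.Automorphic.ShimuraCurveRibetTakahashiOptimalModularityProofs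
import Literature.NumberTheory.EllipticCurves.ModularCurveManinSemistableBridgeProofs
import HarnessLib

/-!
# S-es-g26-1 IS A THEOREM (at `4 ∣ N`): Kato–Néron integrality at `2` passes along an ODD-degree isogeny — and es g26's
# two-power-homothety / odd-neighbour instances of stub 6′ with `2 ∤ c₁`, modulo F-es-21♭K only
# (route `ManinLocalTwoThree`, crux C2 `ManinOddAtFour` stmt-BirchSwinnertonDyer-22967; cell bsd-f2-manin, es g26 MEMO-es §40.12–40.14,
# sketches HOME/es/g26/Sketch-es-g26b.lean dbc55287aac2ede1 §B–§C and Sketch-es-g26c.lean e521510fb324838e; prover ask T-es-39b; p3 gen 12)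

es g26 (§40.12) observed that on the HALF-HOMOTHETY locus `𝓛̄_f = ½Λ₁(f)` (17/21 totally-blind classes `≤ 5000`) the
`X₁(N)`-optimal curve `E₁` IS a symbol-closure curve (`IsSymbolClosureCurve E₁ f`, `u = 2|c₁|`), so the C2 skeleton's stub 6′
(E-es-110 `KatoCurve.KatoNeronIntegralTwoGamma1Optimal`) at `E₁` is the Literature fact F-es-21♭K
(`kato_isIntegral_twistedSymbolSum_two_symbolClosure`) BY NAME, and with the tree theorems `twoAdicGammaOneWitnessLaw_holds`
(E-es-111) + the Γ₁ lever, `2 ∤ c₁`; for the two classes with `ψ(C₀) ≅ ℤ/6` (20a1, 80b1) the symbol-closure curve is only an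
ODD-ISOGENOUS neighbour of `E₁`, and es filed the SUPPORT statement S-es-g26-1 `KatoFactTwoAtOddIsogenyTransfer` (prover ask
T-es-39b).  This file PROVES that support at every level `4 ∣ N` and lands es's §B–§C / g26c consequences by value
(their locus predicates `TwoPowerHomothety` / `OddSymbolClosureNeighbour` are not yet tree definitions — typer ask T-es-39 —
so the hypotheses are spelled out; the by-name forms are one-liners once the leaf lands):

* §1 **`katoFactTwoAt_of_oddIsogeny`** (S-es-g26-1 at `4 ∣ N`): `KatoFactTwoAt V' f → KatoFactTwoAt V f` along `ψ : V' → V` of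
  odd degree between globally minimal curves.  Proof: the newform and `a_ℓ` are shared (`IsNewformOf.of_isIsogenous`; `IsNewformOf`
  pins every `a_ℓ` to `f`), additivity at `2` from `4 ∣ N` (`additive_of_sq_dvd_level`), and the real periods satisfy
  `q·Ω(V') = a·Ω(V)`, `q ∣ deg ψ`, `ab = deg ψ` (`SkinnerUrban2014.exists_int_mul_realPeriodRat_eq_of_isogeny` on modular data from
  `nonempty_modularParametrizationData_of_isNewformOf`) — so the normaliser `ϖ` moves to `ϖq/a` with `q, a` odd and the odd
  cofactor absorbs `|q|`.  The binder `2 ^ 2 ∣ N` stands in for the isogeny invariance of the reduction type at `2`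
  (tree: only via modularity / Ogg–Saito); every C2 consumer lives at `4 ∣ N`.
* §2 `isSymbolClosureCurve_of_isOptimal_of_twoPow` (es g26b §B verbatim on the body `∀ z, z ∈ 𝓛̄_f ↔ 2^j z ∈ Λ₁(f)`).
* §3 `katoFactTwoAt_of_isOptimal_of_twoPow` (stub 6′ on the locus = F-es-21♭K by name), `katoFactTwoAt_of_oddIsogeny_of_isSymbolClosureCurve`
  (stub 6′ on the odd-neighbour locus, now modulo F-es-21♭K ALONE).
* §4 `not_two_dvd_maninConstant₁_of_isOptimal_of_twoPow`, `not_two_dvd_maninConstant₁_of_oddIsogeny_symbolClosure`: `2 ∤ c₁` on both loci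
  at `4 ∣ N` (Γ₁ lever `GammaOneKatoRoad.not_two_dvd_maninConstant₁_of_katoFact_of_witness` + `twoAdicGammaOneWitnessLaw_holds`).

HONEST FRAMING: bookkeeping (periods under isogeny, lattice homothety) around ONE named Literature fact (F-es-21♭K, Kato's explicit
reciprocity law read at the symbol-closure curve; XL, not proved here) and one f-intrinsic LAW (E-es-123 `HalfHomothetyOnTotallyBlind`,
es, census 17/17 — not used in this file).  Nothing about BSD is proved; Manin's conjecture is not proved; C2 OPEN.
[cite: Kato2004Asterisque, (8.1.2)–(8.1.3) (p. 180), Thm. 12.5 (1) (p. 221)] [cite: Wuthrich2014, §1 and §3]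
[cite: SilvermanAEC2009, III.4 and III.6 (isogenies, dual isogeny; shape only)]
-/

set_option autoImplicit false
-- lint-debt: the directory name repeats the summit name (sibling precedent `ManinLocalTwoThreeGammaOneKatoRoad.lean`)
set_option linter.dupNamespace false

noncomputable section

open scoped Classical MatrixGroups ModularForm
open CongruenceSubgroup WeierstrassCurve Literature.NumberTheory.EllipticCurves
open Literature.NumberTheory.EllipticCurves.ModularForms
open Summit.BirchSwinnertonDyer.Rank1Residual.ManinAdditive
open Summit.BirchSwinnertonDyer.Rank1Residual.ManinAdditive.KatoCurve

namespace Summit.BirchSwinnertonDyer.BirchSwinnertonDyer.Theorems.ManinLocalTwoThree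

/-- **S-es-g26-1 (es g26, Sketch-es-g26c `KatoFactTwoAtOddIsogenyTransfer`) at a level `4 ∣ N`, PROVED: Kato–Néron
integrality at `2` (`KatoFactTwoAt · f`, the body of F♯ / F-es-21♭K at one member of the class) passes along an
ODD-degree `ℚ`-isogeny `ψ : V' → V` of globally minimal curves.**  The newform, the Euler factors `a_ℓ` and (at `4 ∣ N`)
the additivity at `2` are shared by `V` and `V'` (`IsNewformOf.of_isIsogenous`, `IsNewformOf` pins `a_ℓ`,
`additive_of_sq_dvd_level`); the real periods satisfy `q·Ω(V') = a·Ω(V)` with `q ∣ deg ψ`, `ab = deg ψ`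
(`SkinnerUrban2014.exists_int_mul_realPeriodRat_eq_of_isogeny`: integral Néron scalings `k k̂ = deg`, read on real parts), so
for odd `deg ψ` the normaliser `ϖ` (`ϖ·Ω(V) = Ω⁺_f`) becomes `ϖ' = ϖ q / a` with `q, a` odd, and the odd cofactor `s`
absorbs `|q|`.  (The binder `2 ^ 2 ∣ N` replaces the isogeny invariance of the reduction type at `2`, which the tree has
only via modularity/Ogg–Saito; every C2 consumer lives at `4 ∣ N`.)
[cite: SilvermanAEC2009, III.6.2 and VI.5 (dual isogeny, periods under isogeny; shape only)] -/
theorem katoFactTwoAt_of_oddIsogeny (V V' : WeierstrassCurve ℚ) [V.IsElliptic] [V.IsGloballyMinimal]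
    [V'.IsElliptic] [V'.IsGloballyMinimal] {N : ℕ} [NeZero N] (f : CuspForm (Gamma0 N) 2) (h4 : 2 ^ 2 ∣ N)
    (ψ : Isogeny V' V) (hodd : Odd ψ.degree) (hK : KatoFactTwoAt V' f) : KatoFactTwoAt V f := by
  haveI : Fact (Nat.Prime 2) := ⟨Nat.prime_two⟩
  intro hf hg hm m _ hcop χ hprim h1 hord h8 ϖ r hϖ hr
  -- the newform and the additivity are shared
  have hiso : WeierstrassCurve.IsIsogenous V' V := ⟨ψ⟩
  have hf' : IsNewformOf V' f := hf.of_isIsogenous hiso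
  obtain ⟨hg', hm'⟩ := additive_of_sq_dvd_level 2 V' f hf' h4
  -- the Euler factors are shared: `a_ℓ(V') = a_ℓ(f) = a_ℓ(V)`
  have hL : ∀ ℓ : ℕ, ((V'.LFunction ℓ : ℤ) : ℂ) = ((V.LFunction ℓ : ℤ) : ℂ) := fun ℓ ↦ by
    rw [← hf'.2 ℓ, hf.2 ℓ]
  -- the real periods: `q Ω(V') = a Ω(V)`, `q ∣ d`, `ab = d`, `d` odd
  obtain ⟨D⟩ := Literature.NumberTheory.Automorphic.nonempty_modularParametrizationData_of_isNewformOf hf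
  obtain ⟨D'⟩ := Literature.NumberTheory.Automorphic.nonempty_modularParametrizationData_of_isNewformOf hf'
  obtain ⟨q, a, b, hq0, hqd, hab, hqa⟩ := SkinnerUrban2014.exists_int_mul_realPeriodRat_eq_of_isogeny D' D ψ
  have hd0 : (ψ.degree : ℤ) ≠ 0 := by exact_mod_cast (Isogeny.degree_pos ψ).ne'
  have ha0 : a ≠ 0 := by rintro rfl; rw [zero_mul] at hab; exact hd0 hab.symm
  have hqodd : Odd q.natAbs := by
    refine Odd.of_dvd_nat hodd ?_
    exact Int.natAbs_dvd_natAbs.mpr hqd |>.trans (by simp)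
  have haodd : Odd a.natAbs := by
    refine Odd.of_dvd_nat hodd ?_
    have : a ∣ (ψ.degree : ℤ) := ⟨b, hab.symm⟩
    exact Int.natAbs_dvd_natAbs.mpr this |>.trans (by simp)
  -- the transported normaliser
  set ϖ' : ℚ := ϖ * q / a with hϖ'def
  have hϖ' : (ϖ' : ℝ) * V'.realPeriodRat = plusPeriod f := by
    have ha0R : (a : ℝ) ≠ 0 := by exact_mod_cast ha0
    have e : (ϖ' : ℝ) * V'.realPeriodRat = (ϖ : ℝ) * ((q : ℝ) * V'.realPeriodRat) / a := by
      rw [hϖ'def]; push_cast; field_simp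
    rw [e, hqa, ← hϖ]
    field_simp
  -- the Euler-corrected sum hypothesis, read at `V'`
  have hr' : (∏ ℓ ∈ N.primeFactors with ¬ ℓ ^ 2 ∣ N,
      (((ℓ : ℂ) - (V'.LFunction ℓ : ℂ) * χ (ℓ : ZMod m)) *
        ((ℓ : ℂ) - (V'.LFunction ℓ : ℂ) * (χ (ℓ : ZMod m))⁻¹))) * twistedSymbolSum f χ =
      r * (plusPeriod f : ℂ) := by
    simp_rw [hL]; exact hr
  obtain ⟨s', hs'odd, hint⟩ := hK hf' hg' hm' m hcop χ hprim h1 hord h8 ϖ' r hϖ' hr'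
  -- undo the transport: `a · (s' ϖ' r) = s' q ϖ r`, and `|q|` is odd
  refine ⟨s' * q.natAbs, ?_, ?_⟩
  · intro h
    rcases (Nat.prime_two.dvd_mul.mp h) with h | h
    · exact hs'odd h
    · exact (Nat.not_even_iff_odd.mpr hqodd) (even_iff_two_dvd.mpr h)
  · have ha0C : (a : ℂ) ≠ 0 := by exact_mod_cast ha0
    have key : ((s' : ℂ) * (ϖ' : ℂ) * r) * (a : ℂ) = (s' : ℂ) * (q : ℂ) * (ϖ : ℂ) * r := by
      rw [hϖ'def]; push_cast; field_simp
    have haZ : IsIntegral ℤ (a : ℂ) := by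
      simpa using (isIntegral_algebraMap : IsIntegral ℤ (algebraMap ℤ ℂ a))
    have hint' : IsIntegral ℤ ((s' : ℂ) * (q : ℂ) * (ϖ : ℂ) * r) := by
      rw [← key]; exact hint.mul haZ
    have e : ((s' * q.natAbs : ℕ) : ℂ) * (ϖ : ℂ) * r = (s' : ℂ) * ((q.natAbs : ℕ) : ℂ) * (ϖ : ℂ) * r := by
      push_cast; ring
    rw [e]
    have hcast : ((q.natAbs : ℕ) : ℂ) = (((q.natAbs : ℕ) : ℤ) : ℂ) := (Int.cast_natCast _).symm
    rw [hcast]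
    rcases le_or_gt 0 q with hq | hq
    · rw [Int.natAbs_of_nonneg hq]; exact hint'
    · rw [Int.ofNat_natAbs_of_nonpos hq.le, Int.cast_neg]
      convert hint'.neg using 1; ring

/-! ## §2 An `X₁(N)`-optimal curve on the two-power-homothety locus IS a symbol-closure curve (es g26b §B, by value) -/

/-- **es g26b §B (MEMO-es §40.12), by value.**  If `𝓛̄_f = 2^{-j} Λ₁(f)` — every `z` lies in the symbol closure
`AddSubgroup.closure (range (modularSymbol f))` iff `2^j z ∈ Λ₁(f)` — and `Λ_V = c₁ Λ₁(f)` (`D₁.IsOptimal`), then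
`Λ_V = (|c₁| 2^j) · 𝓛̄_f`: `V` is a symbol-closure curve for `f` (`IsSymbolClosureCurve`, the hypothesis of F-es-21♭K).
(The locus predicate `TwoPowerHomothety` of the es sketch is not yet a tree definition; its body is the hypothesis `hj`.)
[cite: Wuthrich2014, §1 and §3 (the lattice of all modular symbols; V_Z(f) → c₁·𝓛̄_f)] -/
theorem isSymbolClosureCurve_of_isOptimal_of_twoPow {V : WeierstrassCurve ℚ} {N : ℕ} [NeZero N]
    (D₁ : Gamma1ParametrizationData V N) (hopt : D₁.IsOptimal) (j : ℕ)
    (hj : ∀ z : ℂ, z ∈ AddSubgroup.closure (Set.range (modularSymbol D₁.f)) ↔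
      (2 : ℂ) ^ j * z ∈ periodLatticeGamma1 D₁.f) :
    IsSymbolClosureCurve V D₁.f := by
  have hc : D₁.c ≠ 0 := D₁.maninConstant_ne_zero
  have h2j : ((2 : ℂ) ^ j) ≠ 0 := pow_ne_zero _ two_ne_zero
  have hu : 0 < |(D₁.c : ℝ)| * 2 ^ j :=
    mul_pos (abs_pos.mpr (by exact_mod_cast hc)) (pow_pos two_pos _)
  refine ⟨D₁.L, |(D₁.c : ℝ)| * 2 ^ j, D₁.isNeronLattice, hu, fun z => ⟨fun hz => ?_, ?_⟩⟩
  · obtain ⟨w, hw, hzw⟩ := hopt z hz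
    rcases lt_or_gt_of_ne hc with hneg | hpos
    · refine ⟨-(((2 : ℂ) ^ j)⁻¹ * w), ?_, ?_⟩
      · rw [hj, mul_neg, ← mul_assoc, mul_inv_cancel₀ h2j, one_mul]; exact neg_mem hw
      · have habs : |(D₁.c : ℝ)| = -(D₁.c : ℝ) := abs_of_neg (by exact_mod_cast hneg)
        rw [hzw, habs]; push_cast; field_simp
    · refine ⟨((2 : ℂ) ^ j)⁻¹ * w, ?_, ?_⟩
      · rw [hj, ← mul_assoc, mul_inv_cancel₀ h2j, one_mul]; exact hw
      · have habs : |(D₁.c : ℝ)| = (D₁.c : ℝ) := abs_of_pos (by exact_mod_cast hpos)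
        rw [hzw, habs]; push_cast; field_simp
  · rintro ⟨w, hw, rfl⟩
    have hw' : (2 : ℂ) ^ j * w ∈ periodLatticeGamma1 D₁.f := (hj w).mp hw
    have hmem : (D₁.c : ℂ) * ((2 : ℂ) ^ j * w) ∈ D₁.L.lattice := D₁.smul_periodLatticeGamma1_le _ hw'
    rcases le_or_gt 0 (D₁.c : ℝ) with hnn | hneg
    · have key : (((|(D₁.c : ℝ)| * 2 ^ j : ℝ)) : ℂ) * w = (D₁.c : ℂ) * ((2 : ℂ) ^ j * w) := by
        rw [abs_of_nonneg hnn]; push_cast; ring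
      rw [key]; exact hmem
    · have key : (((|(D₁.c : ℝ)| * 2 ^ j : ℝ)) : ℂ) * w = -((D₁.c : ℂ) * ((2 : ℂ) ^ j * w)) := by
        rw [abs_of_neg hneg]; push_cast; ring
      rw [key]; exact neg_mem hmem

/-! ## §3 Stub 6′ instances from F-es-21♭K: on the locus, and along an odd isogeny from it -/

/-- **Stub 6′ (`KatoCurve.KatoNeronIntegralTwoGamma1Optimal`) INSTANCE on the two-power-homothety locus** (es g26b §C, by
value): for an optimal Γ₁-datum `D₁` on `V` with `𝓛̄_f = 2^{-j} Λ₁(f)`, F-es-21♭K gives `KatoFactTwoAt V D₁.f` at `V` ITSELF.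
[cite: Kato2004Asterisque, (8.1.3) (p. 180) and Thm. 12.5 (1) (p. 221)] -/
theorem katoFactTwoAt_of_isOptimal_of_twoPow (hK : kato_isIntegral_twistedSymbolSum_two_symbolClosure)
    (V : WeierstrassCurve ℚ) [V.IsElliptic] [V.IsGloballyMinimal] {N : ℕ} [NeZero N]
    (D₁ : Gamma1ParametrizationData V N) (hopt : D₁.IsOptimal) (j : ℕ)
    (hj : ∀ z : ℂ, z ∈ AddSubgroup.closure (Set.range (modularSymbol D₁.f)) ↔
      (2 : ℂ) ^ j * z ∈ periodLatticeGamma1 D₁.f) :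
    KatoFactTwoAt V D₁.f :=
  hK V D₁.f (isSymbolClosureCurve_of_isOptimal_of_twoPow D₁ hopt j hj)

/-- **Stub 6′ INSTANCE on the odd-neighbour locus** (es g26c, now a THEOREM modulo F-es-21♭K alone): if `V` (`4 ∣ N`) has a
globally minimal neighbour `V'`, isogenous to `V` by an isogeny of odd degree, which is a symbol-closure curve for `f`, then
`KatoFactTwoAt V f`. [cite: Kato2004Asterisque, (8.1.3) (p. 180) and Thm. 12.5 (1) (p. 221)] -/
theorem katoFactTwoAt_of_oddIsogeny_of_isSymbolClosureCurve (hK : kato_isIntegral_twistedSymbolSum_two_symbolClosure)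
    (V V' : WeierstrassCurve ℚ) [V.IsElliptic] [V.IsGloballyMinimal] [V'.IsElliptic] [V'.IsGloballyMinimal]
    {N : ℕ} [NeZero N] (f : CuspForm (Gamma0 N) 2) (h4 : 2 ^ 2 ∣ N) (ψ : Isogeny V' V) (hodd : Odd ψ.degree)
    (hsc : IsSymbolClosureCurve V' f) : KatoFactTwoAt V f :=
  katoFactTwoAt_of_oddIsogeny V V' f h4 ψ hodd (hK V' f hsc)

/-! ## §4 `2 ∤ c₁` on both loci (Γ₁ lever + the E-es-111 witness theorem) -/

/-- **`2 ∤ c₁` on the two-power-homothety locus at `4 ∣ N`** (es g26b §C): F-es-21♭K + the tree theorems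
`twoAdicGammaOneWitnessLaw_holds` (E-es-111) and `not_two_dvd_maninConstant₁_of_katoFact_of_witness` (the Γ₁ lever);
additivity at `2` from `4 ∣ N`.  BSD is not proved by this; C2 OPEN (conditional on the Literature fact F-es-21♭K).
[cite: Kato2004Asterisque, Thm. 12.5 (1) (p. 221)] -/
theorem not_two_dvd_maninConstant₁_of_isOptimal_of_twoPow (hK : kato_isIntegral_twistedSymbolSum_two_symbolClosure)
    (V : WeierstrassCurve ℚ) [V.IsElliptic] [V.IsGloballyMinimal] {N : ℕ} [NeZero N]
    (D₁ : Gamma1ParametrizationData V N) (hopt : D₁.IsOptimal) (j : ℕ)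
    (hj : ∀ z : ℂ, z ∈ AddSubgroup.closure (Set.range (modularSymbol D₁.f)) ↔
      (2 : ℂ) ^ j * z ∈ periodLatticeGamma1 D₁.f) (h4 : 2 ^ 2 ∣ N) :
    ¬ (2 : ℤ) ∣ D₁.maninConstant := by
  haveI : Fact (Nat.Prime 2) := ⟨Nat.prime_two⟩
  have ha := additive_of_sq_dvd_level 2 V D₁.f D₁.isNewformOf h4
  exact GammaOneKatoRoad.not_two_dvd_maninConstant₁_of_katoFact_of_witness V D₁ hopt
    (katoFactTwoAt_of_isOptimal_of_twoPow hK V D₁ hopt j hj) ha.1 ha.2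
    (twoAdicGammaOneWitnessLaw_holds V D₁ hopt ha.1 ha.2)

/-- **`2 ∤ c₁` on the odd-neighbour locus at `4 ∣ N`** (es g26c `not_two_dvd_maninConstant_of_oddSymbolClosureNeighbour_of_four_dvd`
with its support S-es-g26-1 now PROVED): an optimal Γ₁-datum `D₁` on `V`, a globally minimal `V'` odd-isogenous to `V` which is a
symbol-closure curve for `D₁.f` ⟹ `2 ∤ c₁`, modulo F-es-21♭K.  BSD is not proved by this; C2 OPEN.
[cite: Kato2004Asterisque, Thm. 12.5 (1) (p. 221)] -/
theorem not_two_dvd_maninConstant₁_of_oddIsogeny_symbolClosure (hK : kato_isIntegral_twistedSymbolSum_two_symbolClosure)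
    (V V' : WeierstrassCurve ℚ) [V.IsElliptic] [V.IsGloballyMinimal] [V'.IsElliptic] [V'.IsGloballyMinimal]
    {N : ℕ} [NeZero N] (D₁ : Gamma1ParametrizationData V N) (hopt : D₁.IsOptimal)
    (ψ : Isogeny V' V) (hodd : Odd ψ.degree) (hsc : IsSymbolClosureCurve V' D₁.f) (h4 : 2 ^ 2 ∣ N) :
    ¬ (2 : ℤ) ∣ D₁.maninConstant := by
  haveI : Fact (Nat.Prime 2) := ⟨Nat.prime_two⟩
  have ha := additive_of_sq_dvd_level 2 V D₁.f D₁.isNewformOf h4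
  exact GammaOneKatoRoad.not_two_dvd_maninConstant₁_of_katoFact_of_witness V D₁ hopt
    (katoFactTwoAt_of_oddIsogeny_of_isSymbolClosureCurve hK V V' D₁.f h4 ψ hodd hsc) ha.1 ha.2
    (twoAdicGammaOneWitnessLaw_holds V D₁ hopt ha.1 ha.2)

end Summit.BirchSwinnertonDyer.BirchSwinnertonDyer.Theorems.ManinLocalTwoThree

end
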